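import Summits.QuantumFields.YangMills.Theorems.BalabanUVNodesN15NeumannCubeRightEntriesDefect
import Summits.QuantumFields.YangMills.Theorems.BalabanUVNodesN15TwoGridEntry2Forward
import HarnessLib

/-!
# N15 (NE2) — two-spacing gluing, part N-IIr: ★★★ (c)⁺ BINDER-FREE — THE TWO-GRID DEFECT OF THE NEUMANN CUBE's FORWARD RIGHT ENTRY `T⁺_ν = χ_□·Sym∘(G∘∇_ν)∘M_χ`

WHO ∕ WHEN.  Cell `pub-ymgap`, seat `pub-ymgap-dag-n15-a` (g22); `--supports stmt-QuantumFields-27366 --as helper` (count-neutral).  Closes the programme N-IIn → N-IIo → N-IIp →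
N-IIq of this seat: N-IIo typed (c)⁺ CONDITIONALLY on the torus letter `hSrc` of `𝔇(G′∘ρ′(sD′_ν n′), G∘ρ(sD_ν n))` (dag-n15-c g13: «GO CONDITIONAL on hSrc»); N-IIq proved that
letter (`hasMaj_twoGridDefect_grad_fwd`); this file feeds it.  (dag-n15-c g13's WANT g13-1, forward half, is now hypothesis-free.)
WHAT.  ★★★ `hasMaj_idef_rightGrad`: for odd `L ≥ 3`, `a > 0`: `∃ δ m > 0 ∀ m_T, k ≥ 1 (4 ≤ L^k), hL, c, ν`, the two-grid defect `𝔇(T⁺′_ν, T⁺_ν)` of the Neumann cube's forward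
right entry (images method, cube `□ = □(c, L^{m_T})` on the doubled torus of record) has the block majorant `1_□(y)1_□(y′)·m·(L^k)^{−1∕(8(d+1))}·e^{−δ|y−y′|_T}` — N-IIo's
`hasMaj_idef_rightGrad_of_torusDefect` with its displayed binder DISCHARGED by N-IIq.
HONEST FRAMING ∕ LIMITS.  Bookkeeping over LANDED rows only; no new analytic estimate; `U ≡ 1` torus MODEL of [B5] §1 (doubled cube tori, reflecting boundary conditions by
images); nothing of [B6] (2.38)–(2.40)∕[B9] asserted; N15 NOT discharged (object-bound; NE2⁺ NOT PRINTED); counts UNMOVED (typed 28∕28 · discharged 5∕27); one finite torus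
pair per index — NOT continuum ∕ ℝ⁴ ∕ OS ∕ mass gap ∕ Clay.  Theorems only (0 `def`).
-/

open scoped BigOperators Matrix
open Finset

namespace Summit.QuantumFields.YangMills.BalabanUVNodes.N15.TwoGrid

open Literature.MathematicalPhysics.QuantumFieldTheory.Balaban1983to89
open Literature.MathematicalPhysics.QuantumFieldTheory.Balaban1983to89.B5Prop11Plancherel (Tor fine unitVec)
open Literature.MathematicalPhysics.QuantumFieldTheory.Balaban1983to89.B6Prop26Gluing (mulOp mulOp_apply ind ind_nonneg ind_le_one)
open Literature.MathematicalPhysics.QuantumFieldTheory.King1986.Torus (blockOf tdistT tdistT_nonneg)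
open Literature.MathematicalPhysics.QuantumFieldTheory.Balaban1983to89.T4EtaRateDefect (idef)
open Literature.MathematicalPhysics.QuantumFieldTheory.Balaban1983to89.T4EtaRateCoeffDefect (pull)
open Literature.MathematicalPhysics.QuantumFieldTheory.Balaban1983to89.B11SectG (BlockNorm HasMaj)
open Literature.MathematicalPhysics.QuantumFieldTheory.Balaban1983to89.B6UnitTorusCarrier (unitTorusGeo)
open Literature.MathematicalPhysics.QuantumFieldTheory.Balaban1983to89.B5SiteBridgeP12 (MP)
open Literature.MathematicalPhysics.QuantumFieldTheory.Balaban1983to89.B5SettingP12Real (latticeSettingP12R)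
open Summit.QuantumFields.YangMills.BalabanUVNodes.N15.VectorPiece (kingPrV blkFine)

variable {d : ℕ}

section Closed

variable {L : ℕ} [NeZero L]

/-- ★★★ **(c)⁺ BINDER-FREE: THE TWO-GRID DEFECT OF THE NEUMANN CUBE's FORWARD RIGHT ENTRY**: for odd `L ≥ 3` and `a > 0` there are `δ, m > 0` such that for every torus
exponent `m_T`, coarse scale `k ≥ 1` with `4 ≤ L^k`, refinement exponent `r`, cube corner `c` and direction `ν`,
`𝔇(χ′_□Sym′(G′∇′_ν)M_{χ′}, χ_□Sym(G∇_ν)M_χ) ≤ 1_□(y)1_□(y′)·m·(L^k)^{−1∕(8(d+1))}·e^{−δ|y−y′|_T}` — N-IIo's `hasMaj_idef_rightGrad_of_torusDefect` fed with N-IIq's torus letter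
`hasMaj_twoGridDefect_grad_fwd`. [cite: Balaban1984PropagatorsII, (2.38)–(2.40) p.228 (the Neumann cube propagator by images: shape); Balaban1985BackgroundPropagators, Thm 3.1 (3.42)
p.397 (the entry G∇*); Balaban1984PropagatorsI, Prop. 1.2 (1.110)–(1.114) pp.35–36] -/
theorem hasMaj_idef_rightGrad (hLodd : Odd L) (hL2 : 2 ≤ L) {a : ℝ} (ha : 0 < a) :
    ∃ δ m : ℝ, 0 < δ ∧ 0 < m ∧ ∀ (mT k r : ℕ) (hk : 1 ≤ k) (hn4 : 4 ≤ L ^ k) (hL : Odd L ∧ 1 < L) (c : Tor (MP (paramsOf d L mT k hL))) (ν : Fin (d + 1)),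
      HasMaj (BlockNorm.ofBlocks (unitTorusGeo L k (MP (paramsOf d L mT k hL))) (blkFine L k (MP (paramsOf d L mT k hL))))
        (BlockNorm.ofBlocks (unitTorusGeo L k (MP (paramsOf d L mT k hL)))
          (fun i : Tor (fine (L ^ r * L ^ k) (MP (paramsOf d L mT k hL))) × Fin (d + 1) => blockOf (L ^ r * L ^ k) (MP (paramsOf d L mT k hL)) i.1))
        (idef (pull (kingPrV L k r (MP (paramsOf d L mT k hL)))) (pull (kingPrV L k r (MP (paramsOf d L mT k hL))))
          (mulOp (chiCube (MP (paramsOf d L mT k hL)) (L ^ r * L ^ k) c (L ^ mT)) ∘ₗ symOp (MP (paramsOf d L mT k hL)) (L ^ r * L ^ k) c ∘ₗ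
            (gOp (MP (paramsOf d L mT k hL)) (L ^ r * L ^ k) a ∘ₗ
              symbOp (MP (paramsOf d L mT k hL)) (L ^ r * L ^ k) (sD (MP (paramsOf d L mT k hL)) (L ^ r * L ^ k) ν ((L ^ r * L ^ k : ℕ) : ℝ))) ∘ₗ
            mulOp (chiCube (MP (paramsOf d L mT k hL)) (L ^ r * L ^ k) c (L ^ mT)))
          (mulOp (chiCube (MP (paramsOf d L mT k hL)) (L ^ k) c (L ^ mT)) ∘ₗ symOp (MP (paramsOf d L mT k hL)) (L ^ k) c ∘ₗ
            (gOp (MP (paramsOf d L mT k hL)) (L ^ k) a ∘ₗ symbOp (MP (paramsOf d L mT k hL)) (L ^ k) (sD (MP (paramsOf d L mT k hL)) (L ^ k) ν ((L ^ k : ℕ) : ℝ))) ∘ₗ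
            mulOp (chiCube (MP (paramsOf d L mT k hL)) (L ^ k) c (L ^ mT))))
        (fun y y' => ind ((cubeBlocks (MP (paramsOf d L mT k hL)) c (L ^ mT) : Finset _) : Set _) y *
          ind ((cubeBlocks (MP (paramsOf d L mT k hL)) c (L ^ mT) : Finset _) : Set _) y' *
          (m * ((L ^ k : ℕ) : ℝ) ^ (-(1 / (8 * ((d : ℝ) + 1)))) * Real.exp (-(δ * tdistT (MP (paramsOf d L mT k hL)) y y')))) := by
  obtain ⟨δs, Cs, hδs, hCs, H⟩ := hasMaj_twoGridDefect_grad_fwd (d := d) hLodd hL2 ha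
  exact hasMaj_idef_rightGrad_of_torusDefect (d := d) hLodd hL2 ha hδs hCs.le fun mT k r hk hL ν => H mT k r hk hL ν

end Closed

end Summit.QuantumFields.YangMills.BalabanUVNodes.N15.TwoGrid
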